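import Summits.BirchSwinnertonDyer.BirchSwinnertonDyer.Theorems.GoldfeldAllTwistsTwoConverseTwinAdditiveBaseTwists
import Summits.BirchSwinnertonDyer.BirchSwinnertonDyer.Theorems.GoldfeldK12AdditiveTwoBaseChange
import Literature.NumberTheory.EllipticCurves.QuadraticTwistNegOneRootNumberProofs
import Literature.NumberTheory.EllipticCurves.QuadraticTwistTwoLFunctionProofs
import Literature.NumberTheory.EllipticCurves.BSDSelmerSmithRootNumberDensityProofs
import Literature.NumberTheory.EllipticCurves.BSDRootNumberModularityOnlyProofs
import Literature.NumberTheory.EllipticCurves.BSDRootNumberOddParityProofs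
import Literature.NumberTheory.EllipticCurves.BSDConductor
import Literature.NumberTheory.EllipticCurves.SzpiroLocalDataProofs
import Literature.NumberTheory.EllipticCurves.LFunctionPrimeCoeff
import Literature.NumberTheory.EllipticCurves.TamagawaPrimesEquivProofs
import Literature.NumberTheory.EllipticCurves.ComplexMultiplicationNotSemistable
import Literature.NumberTheory.EllipticCurves.RootNumberSmulProofs
import Literature.NumberTheory.EllipticCurves.LFunctionSmulProofs
import Literature.NumberTheory.DiophantineGeometry.LocalReductionIsIntegralAtProofs
import Literature.NumberTheory.DiophantineGeometry.LocalReductionFiniteBadPlacesProofs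
import Literature.NumberTheory.DiophantineGeometry.ConductorExponentZeroProofs
import Summits.BirchSwinnertonDyer.Uniform.U2.GenusTwistSignLaw
import HarnessLib

set_option linter.dupNamespace false -- namespace `…BirchSwinnertonDyer.BirchSwinnertonDyer…` is the cell's (D-0017 nested layout)
set_option autoImplicit false

/-!
# Route `GoldfeldAllTwistsTwoConverse`, crux twin″ `BSDTwoCMSevenAdditiveRankOne` (item 19140):
# the SIGN of the additive cell (part 1) — `N(X₀(49)) = 49`, root numbers and conductors of ALL
# quadratic twists `49a1^{(d)}` with `7 ∤ d`

Cell `bsd-goldfeld`, seat `bsd-goldfeld-s1p-c301` (prover, gen 3), item `stmt-BirchSwinnertonDyer-19140`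
(route decl `Summit.BirchSwinnertonDyer.BirchSwinnertonDyer.Theses.GoldfeldAllTwistsTwoConverse.BSDTwoCMSevenAdditiveRankOne`,
twin″: Miller's `BSD(W,2)` for every globally minimal `ℚ(√−7)`-CM `W/ℚ` NOT good at `2` with `r_an = 1`).
The item is OPEN mathematics (BSD(·,2) at a wild prime in analytic rank one is unprinted — cell memos
TWINPP-LEAF, PRIME-TWIST-DESCENT); nothing here proves it. Theorems only: no definition, no axiom, no
`sorry`, no instance, no notation; every published input is an explicit named-fact binder.

Files 1–3 of this seat (`…TwinAdditiveReduction`, `…TwinAdditiveHeegnerIndex`, `…TwinAdditiveBaseTwists`)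
put the item in twist currency: it is `BSD(·,2)` for the minimal models of the analytic-rank-one twists
`49a1^{(d)}`, `d` squarefree, `d ≢ 1 (mod 4)`. This file decides the SIGN of the functional equation on
that family, from the tree's Murty–Murty / Atkin–Lehner twist formulas (proved in the tree from the
Modularity Theorem `exists_isNewformOf`):

* §1 **`N(X₀(49)) = 49`** (`conductorNorm_cm7`), decided by the kernel: `f₇ = 2` (the model
  `[1, −1, 0, −2, −1]` is minimal at `7`, `7 ∣ Δ = −7³`, `7 ∣ c₄ = 105`, additive, `p ≥ 5`; Silverman
  *ATAEC* IV.10.2 via `conductorExponent_eq_two_of_five_le_of_isElliptic`), `f_p = 0` for `p ≠ 7`.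
* §2 `w(X₀(49)) = +1` (`rootNumber_cm7`, from `L(X₀(49),1) ≠ 0` = Coates–Li–Tian–Zhai Thm. 1.2 at
  `R = 1`, binder `h12`, and the unconditional half of the parity fact); the three additive base curves:
  `w(49a1^{(−1)}) = −1`, `N = 784 = 28²`; `w(49a1^{(2)}) = +1`, `w(49a1^{(−2)}) = −1`, `N = 3136 = 56²`
  (`rootNumber_and_conductorNorm_quadraticTwist_cm7_neg_one/_two/_neg_two/_base`; the twists `49a1^{(ε)}`
  are ADDITIVE at `2`: `hasAdditiveReductionAt_quadraticTwist_cm7_base`, Barrios et al. rows `I₀` + CM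
  never multiplicative).
* §3 **`w(49a1^{(d)}) = sign d` for EVERY squarefree `d` with `7 ∤ d`** (`rootNumber_quadraticTwist_cm7`),
  good and additive twists alike: along `d = ε·m`, `ε ∈ {1, −1, 2, −2}`, `m ≡ 1 (mod 4)`,
  `w(49a1^{(εm)}) = (−1/|m|)(N_ε/|m|) w(49a1^{(ε)})` with `N_ε ∈ {7², 28², 56²}` a square prime to `m`;
  conductors `N(49a1^{(d)}) = 49 d²` (`d ≡ 1 (mod 4)`), `784 m²` (`d = −m ≡ 3 (mod 4)`), `3136 m²`
  (`d = ±2m`) — `conductorNorm_quadraticTwist_cm7_of_emod_four_eq_one`, `conductorNorm_quadraticTwist_cm7_base_mul`.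
  In words: `w(X₀(49) ⊗ χ_d) = χ_d(−49)·w(X₀(49)) = χ_d(−1)`.
* The sequel (`…TwinAdditiveSign`, part 2) draws the consequences for the item: every model of a positive
  twist prime to `7` has EVEN analytic rank, so twin″ ⟺ its restriction to the NEGATIVE twists
  `49a1^{(d)}`, `d < 0`, `7 ∤ d`, `d ≢ 1 (mod 4)` (granted Cassels/GZK/continuation for the isogeny
  `49a1^{(7e)} ∼ 49a1^{(−e)}`).

HONEST FRAMING: bookkeeping of the sign; the `2`-part of BSD for a single additive curve is not touched.
The binder `h12` (CLTZ Thm. 1.2, used only at `R = 1` for `L(X₀(49), 1) ≠ 0`) could be replaced by any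
proof of `w(X₀(49)) = +1`; the tree's local-root-number product is not available at the additive prime `7`
of `X₀(49)` only because Rohrlich's table is typed for `p ≥ 5` on `ℤ_[p]`-models (not needed here).

References: M. R. Murty, V. K. Murty, *Non-vanishing of L-functions and applications* (1997) Ch. 6 §1
[MurtyMurty1997]; A. O. L. Atkin, J. Lehner, Math. Ann. 185 (1970) §6 [AtkinLehner1970]; J. H. Silverman,
*Advanced Topics* (1994) IV.10.2 [Silverman1994]; J. H. Silverman, *AEC* (2009) VII.5.1, C.16 [SilvermanAEC2009];
J. Coates, Y. Li, Y. Tian, S. Zhai, PLMS 110 (2015) Thm. 1.2, §1 [CoatesLiTianZhai2015]; J. E. Cremona,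
*Algorithms for Modular Elliptic Curves* (1997) Table 1 [CremonaAlgorithms1997]; A. Barrios et al. 2025 Thm. 5.1
[BarriosEtAl2025]; J. S. Milne, *ADT* Thm. I.7.3 [MilneADT2006]; R. L. Miller, LMS JCM 14 (2011) Def. 1.1 [Miller2011LMS].
-/

noncomputable section

open scoped Classical NumberTheorySymbols

open WeierstrassCurve IsDedekindDomain NumberField Rat.HeightOneSpectrum
  Literature.NumberTheory.EllipticCurves Literature.NumberTheory.EllipticCurves.ModularForms
  Literature.NumberTheory.EllipticCurves.Rank1Residual

namespace Summit.BirchSwinnertonDyer.BirchSwinnertonDyer.Theorems.GoldfeldGoodTwists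

/-! ## §1 The conductor of `X₀(49)` is `49` (decided by the kernel) -/

/-- `cm7 = [1, −1, 0, −2, −1] / ℚ` is the base change of its integer model. [folklore] -/
theorem cm7_eq_baseChange_int49a1 : cm7 = (⟨1, -1, 0, -2, -1⟩ : WeierstrassCurve ℤ).baseChange ℚ := by
  ext <;> simp [WeierstrassCurve.baseChange, WeierstrassCurve.map]

/-- `Δ(49a1) = −7³`. [cite: CremonaAlgorithms1997, Table 1 (curve 49a1)] -/
theorem int49a1_Δ : (⟨1, -1, 0, -2, -1⟩ : WeierstrassCurve ℤ).Δ = -343 := by decide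

/-- `c₄(49a1) = 105 = 3·5·7`. [cite: CremonaAlgorithms1997, Table 1 (curve 49a1)] -/
theorem int49a1_c₄ : (⟨1, -1, 0, -2, -1⟩ : WeierstrassCurve ℤ).c₄ = 105 := by decide

/-- `f₇(X₀(49)) = 2`: at `7` the model `[1, −1, 0, −2, −1]` is minimal (`7⁴ ∤ c₄ = 105`) with
`7 ∣ Δ`, `7 ∣ c₄`, hence ADDITIVE reduction (Silverman VII.5.1(c)), and an additive prime `p ≥ 5`
has conductor exponent `2` (Silverman *ATAEC* IV.10.2; tree theorem
`conductorExponent_eq_two_of_five_le_of_isElliptic`). [cite: Silverman1994, IV.10.2 (c)] -/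
theorem conductorExponent_cm7_seven :
    cm7.conductorExponent ((primesEquiv (R := ℤ)).symm ⟨7, by norm_num⟩) = 2 := by
  set v := (primesEquiv (R := ℤ)).symm ⟨7, by norm_num⟩ with hv
  have hgen : natGenerator v = 7 :=
    Literature.NumberTheory.EllipticCurves.Rat.natGenerator_primesEquiv_symm ⟨7, by norm_num⟩
  rw [cm7_eq_baseChange_int49a1]
  haveI : ((⟨1, -1, 0, -2, -1⟩ : WeierstrassCurve ℤ).baseChange ℚ).IsElliptic := by rw [← cm7_eq_baseChange_int49a1]; infer_instance
  have hmin : ((⟨1, -1, 0, -2, -1⟩ : WeierstrassCurve ℤ).baseChange ℚ).IsMinimalAt v := by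
    refine isMinimalAt_of_lt_valuation_c₄ (isIntegralAt_baseChange v (⟨1, -1, 0, -2, -1⟩ : WeierstrassCurve ℤ)) ?_
    rw [baseChange_int_c₄]
    exact (Literature.NumberTheory.EllipticCurves.Rat.exp_lt_valuation_intCast_iff v ((⟨1, -1, 0, -2, -1⟩ : WeierstrassCurve ℤ).c₄) 4).mpr
      (by rw [hgen, int49a1_c₄]; decide)
  refine conductorExponent_eq_two_of_five_le_of_isElliptic _ v (by rw [hgen]; norm_num)
    ((hasAdditiveReductionAt_iff_of_isMinimalAt hmin).mpr ⟨?_, ?_⟩)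
  · rw [baseChange_int_Δ, Literature.NumberTheory.EllipticCurves.Rat.valuation_intCast_lt_one_iff, hgen,
      int49a1_Δ]
    decide
  · rw [baseChange_int_c₄, Literature.NumberTheory.EllipticCurves.Rat.valuation_intCast_lt_one_iff, hgen,
      int49a1_c₄]
    decide

/-- `f_p(X₀(49)) = 0` for `p ≠ 7`: `p ∤ Δ = −7³`, so the integral model has `p`-unit discriminant and
good reduction at `p` (Silverman VII.5.1(a); `conductorExponent_eq_zero_iff`). [cite: Silverman1994, IV.10.2 (a)] -/
theorem conductorExponent_cm7_of_ne_seven {p : ℕ} (hp : p.Prime) (hp7 : p ≠ 7) :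
    cm7.conductorExponent ((primesEquiv (R := ℤ)).symm ⟨p, hp⟩) = 0 := by
  set v := (primesEquiv (R := ℤ)).symm ⟨p, hp⟩ with hv
  have hgen : natGenerator v = p :=
    Literature.NumberTheory.EllipticCurves.Rat.natGenerator_primesEquiv_symm ⟨p, hp⟩
  rw [cm7_eq_baseChange_int49a1]
  haveI : ((⟨1, -1, 0, -2, -1⟩ : WeierstrassCurve ℤ).baseChange ℚ).IsElliptic := by rw [← cm7_eq_baseChange_int49a1]; infer_instance
  refine (conductorExponent_eq_zero_iff_holds v _).mpr
    (hasGoodReductionAt_of_valuation_Δ_eq_one_holds v _ (isIntegralAt_baseChange v (⟨1, -1, 0, -2, -1⟩ : WeierstrassCurve ℤ)) ?_)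
  rw [baseChange_int_Δ, Literature.NumberTheory.EllipticCurves.Rat.valuation_intCast_eq_one_iff, hgen,
    int49a1_Δ]
  intro h
  have h7 : (p : ℤ) ∣ 7 ^ 3 := by
    have : (-343 : ℤ) = -(7 ^ 3) := by norm_num
    rw [this, dvd_neg] at h
    exact h
  have := Int.Prime.dvd_pow' hp h7
  have hp7' : p ∣ 7 := by exact_mod_cast this
  exact hp7 ((Nat.prime_dvd_prime_iff_eq hp (by norm_num)).mp hp7')

/-- **`N(X₀(49)) = 49`**: the conductor of `cm7 = 49a1` is `7²` (`f₇ = 2`, `f_p = 0` otherwise,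
`N = ∏ p^{f_p}`). [cite: CremonaAlgorithms1997, Table 1 (curve 49a1)] [cite: Silverman1994, IV.10.2] -/
theorem conductorNorm_cm7 : cm7.conductorNorm ℤ = 49 := by
  refine Nat.eq_of_factorization_eq (cm7.conductorNorm_pos_holds).ne' (by norm_num) fun p ↦ ?_
  by_cases hp : p.Prime
  swap
  · rw [Nat.factorization_eq_zero_of_not_prime _ hp, Nat.factorization_eq_zero_of_not_prime _ hp]
  rw [show p = ((⟨p, hp⟩ : Nat.Primes) : ℕ) from rfl, factorization_conductorNorm_primesEquiv_symm,
    show (49 : ℕ) = 7 ^ 2 by norm_num, Nat.factorization_pow, Nat.Prime.factorization (by norm_num : Nat.Prime 7)]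
  simp only [Finsupp.coe_smul, Pi.smul_apply, Finsupp.single_apply, smul_eq_mul]
  by_cases hp7 : p = 7
  · subst hp7
    rw [if_pos rfl, mul_one]
    exact conductorExponent_cm7_seven
  · rw [if_neg (Ne.symm hp7), mul_zero]
    exact conductorExponent_cm7_of_ne_seven hp hp7


/-! ## §2 Root number of `X₀(49)` and of the three additive base curves `49a1^{(−1)}`, `49a1^{(±2)}` -/

/-- **`w(X₀(49)) = +1`**: `ord_{s=1} L(X₀(49), s) = 0` (`L(X₀(49), 1) ≠ 0`, Coates–Li–Tian–Zhai Thm. 1.2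
at `R = 1`, tree theorem `analyticRank_cm7`), and an even analytic rank forces root number `+1`
unconditionally (`rootNumber_eq_one_of_even_analyticRank`).
[cite: CoatesLiTianZhai2015, Thm. 1.2 (p. 359, case r = 0)] [cite: SilvermanAEC2009, C.16 Thm. 16.3 and remark, p. 451] -/
theorem rootNumber_cm7 (h12 : CoatesLiTianZhai2015.thm12_fullBSD_twist) : cm7.rootNumber = 1 :=
  rootNumber_eq_one_of_even_analyticRank (W := cm7) (by rw [analyticRank_cm7 h12]; exact Even.zero)

/-- `X₀(49)` has good reduction at the place of `ℚ` above `2` (place-indexed form of the tree's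
`hasGoodReductionAtPrime_cm7_two`, through the bridge `hasGoodReductionAtPrime_primesEquiv_iff_holds`).
[cite: SilvermanAEC2009, VII.5 Prop. 5.1(a)] -/
theorem hasGoodReductionAt_cm7_of_natGenerator_eq_two (w : HeightOneSpectrum (𝓞 ℚ))
    (hw : natGenerator w = 2) : cm7.HasGoodReductionAt w :=
  haveI : Fact (2 : ℕ).Prime := ⟨Nat.prime_two⟩
  (hasGoodReductionAtPrime_primesEquiv_iff_holds cm7 w 2 hw).mp hasGoodReductionAtPrime_cm7_two

/-- **The twist `49a1^{(ε)}`, `ε ∈ {−1, 2, −2}`, is ADDITIVE at `2`**: it is not good at `2` (Barrios et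
al. 2025 rows `I₀`, tree theorem `not_hasGoodReductionAtPrime_two_of_smul_eq_quadraticTwist`, `ε ≡ 3, 2, 2
(mod 4)`), and a CM curve (`j = −3375`) is never multiplicative (`not_hasMultiplicativeReductionAtPrime_of_hasCM`);
local trichotomy. [cite: BarriosEtAl2025, Thm. 5.1 (rows R = I₀)] [cite: SilvermanATAEC1994, Thm. II.6.4 and proof of Thm. II.10.5] -/
theorem hasAdditiveReductionAt_quadraticTwist_cm7_base {ε : ℤ} (hε : ε = -1 ∨ ε = 2 ∨ ε = -2)
    (v : HeightOneSpectrum (𝓞 ℚ)) (hv : (primesEquiv v : ℕ) = 2) :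
    (cm7.quadraticTwist (ε : ℚ)).HasAdditiveReductionAt v := by
  haveI : Fact (2 : ℕ).Prime := ⟨Nat.prime_two⟩
  have hε0 : ε ≠ 0 := by rcases hε with rfl | rfl | rfl <;> decide
  have hεQ : (ε : ℚ) ≠ 0 := Int.cast_ne_zero.mpr hε0
  haveI := cm7.isElliptic_quadraticTwist hεQ
  have hng : ¬ (cm7.quadraticTwist (ε : ℚ)).HasGoodReductionAtPrime 2 :=
    not_hasGoodReductionAtPrime_two_of_smul_eq_quadraticTwist cm7 (cm7.quadraticTwist (ε : ℚ))
      hasGoodReductionAtPrime_cm7_two (d := ε) (by rcases hε with rfl | rfl | rfl <;> decide)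
      (C := (1 : VariableChange ℚ)) (one_smul _ _)
  have hnm : ¬ (cm7.quadraticTwist (ε : ℚ)).HasMultiplicativeReductionAtPrime 2 :=
    not_hasMultiplicativeReductionAtPrime_of_hasCM _
      (hasCM_of_j_eq_neg3375 _ (by rw [j_quadraticTwist cm7 hεQ, j_cm7])) 2
  rcases hasGoodReductionAt_or_hasMultiplicativeReductionAt_or_hasAdditiveReductionAt v
    (cm7.quadraticTwist (ε : ℚ)) with hg | hm | ha
  · exact absurd ((hasGoodReductionAtPrime_primesEquiv_iff_holds _ v 2 hv).mpr hg) hng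
  · exact absurd ((hasMultiplicativeReductionAtPrime_primesEquiv_iff_holds _ v 2 hv).mpr hm) hnm
  · exact ha

/-- **`w(49a1^{(−1)}) = −1` and `N(49a1^{(−1)}) = 784 = 16·49`** (Murty–Murty 1997 Ch. 6 §1 with
`D = −4`: `w(E^{(−1)}) = −χ₄(N) w(E)` for odd `N` when `E^{(−1)}` is additive at `2`; Atkin–Lehner: level
`16 N`; here `N = 49 ≡ 1 (mod 4)`, `w(X₀(49)) = +1`). [cite: MurtyMurty1997, Ch. 6 §1] [cite: AtkinLehner1970, §6] -/
theorem rootNumber_and_conductorNorm_quadraticTwist_cm7_neg_one (hnf : exists_isNewformOf)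
    (h12 : CoatesLiTianZhai2015.thm12_fullBSD_twist) :
    (cm7.quadraticTwist (-1)).rootNumber = -1 ∧ (cm7.quadraticTwist (-1)).conductorNorm ℤ = 784 := by
  have h := cm7.rootNumber_quadraticTwist_neg_one hnf (by rw [conductorNorm_cm7]; norm_num)
    (fun v hv ↦ by exact_mod_cast hasAdditiveReductionAt_quadraticTwist_cm7_base (Or.inl rfl) v hv)
  rw [conductorNorm_cm7, rootNumber_cm7 h12, ZMod.χ₄_nat_one_mod_four (by norm_num)] at h
  exact ⟨by rw [h.1]; norm_num, by rw [h.2]⟩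

/-- **`w(49a1^{(2)}) = +1` and `N(49a1^{(2)}) = 3136 = 64·49`** (Murty–Murty 1997 Ch. 6 §1 with `D = 8`:
`w(E^{(2)}) = χ₈(N) w(E)` for `E` good at `2` of odd conductor; Atkin–Lehner: level `64 N`; `χ₈(49) = 1`).
[cite: MurtyMurty1997, Ch. 6 §1] [cite: AtkinLehner1970, §6] -/
theorem rootNumber_and_conductorNorm_quadraticTwist_cm7_two (hnf : exists_isNewformOf)
    (h12 : CoatesLiTianZhai2015.thm12_fullBSD_twist) :
    (cm7.quadraticTwist 2).rootNumber = 1 ∧ (cm7.quadraticTwist 2).conductorNorm ℤ = 3136 := by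
  have h := cm7.rootNumber_quadraticTwist_two hnf (by rw [conductorNorm_cm7]; norm_num)
    hasGoodReductionAt_cm7_of_natGenerator_eq_two
  rw [conductorNorm_cm7, rootNumber_cm7 h12, ZMod.χ₈_nat_eq_if_mod_eight] at h
  norm_num at h
  exact ⟨h.1, h.2⟩

/-- **`w(49a1^{(−2)}) = −1` and `N(49a1^{(−2)}) = 3136 = 64·49`** (Murty–Murty 1997 Ch. 6 §1 with `D = −8`:
`w(E^{(−2)}) = −χ₈'(N) w(E)`; `χ₈'(49) = 1`). [cite: MurtyMurty1997, Ch. 6 §1] [cite: AtkinLehner1970, §6] -/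
theorem rootNumber_and_conductorNorm_quadraticTwist_cm7_neg_two (hnf : exists_isNewformOf)
    (h12 : CoatesLiTianZhai2015.thm12_fullBSD_twist) :
    (cm7.quadraticTwist (-2)).rootNumber = -1 ∧ (cm7.quadraticTwist (-2)).conductorNorm ℤ = 3136 := by
  have h := cm7.rootNumber_quadraticTwist_neg_two hnf (by rw [conductorNorm_cm7]; norm_num)
    hasGoodReductionAt_cm7_of_natGenerator_eq_two
  rw [conductorNorm_cm7, rootNumber_cm7 h12, ZMod.χ₈'_nat_eq_if_mod_eight] at h
  norm_num at h
  exact ⟨h.1, h.2⟩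

/-- The three base cases in one statement: for `ε ∈ {−1, 2, −2}`, `w(49a1^{(ε)}) = sign ε` and
`N(49a1^{(ε)}) = (if ε = −1 then 784 else 3136)`, a perfect square (`28²`, `56²`).
[cite: MurtyMurty1997, Ch. 6 §1] [cite: AtkinLehner1970, §6] -/
theorem rootNumber_and_conductorNorm_quadraticTwist_cm7_base (hnf : exists_isNewformOf)
    (h12 : CoatesLiTianZhai2015.thm12_fullBSD_twist) {ε : ℤ} (hε : ε = -1 ∨ ε = 2 ∨ ε = -2) :
    (cm7.quadraticTwist (ε : ℚ)).rootNumber = Int.sign ε ∧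
      (cm7.quadraticTwist (ε : ℚ)).conductorNorm ℤ = if ε = -1 then 28 ^ 2 else 56 ^ 2 := by
  rcases hε with rfl | rfl | rfl
  · have h := rootNumber_and_conductorNorm_quadraticTwist_cm7_neg_one hnf h12
    norm_num at h ⊢
    exact h
  · have h := rootNumber_and_conductorNorm_quadraticTwist_cm7_two hnf h12
    norm_num at h ⊢
    exact h
  · have h := rootNumber_and_conductorNorm_quadraticTwist_cm7_neg_two hnf h12
    norm_num at h ⊢
    exact h


/-! ## §3 Root number and conductor of EVERY twist `49a1^{(d)}` with `7 ∤ d`: `w = sign d` -/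

/-- An odd natural number prime to `7` is coprime to `2^a · 7^b`. [folklore] -/
theorem coprime_two_pow_mul_seven_pow {m : ℕ} (h2 : ¬ 2 ∣ m) (h7 : ¬ 7 ∣ m) (a b : ℕ) :
    m.Coprime (2 ^ a * 7 ^ b) :=
  Nat.Coprime.mul_right
    (Nat.Coprime.pow_right a ((Nat.prime_two.coprime_iff_not_dvd.mpr h2).symm))
    (Nat.Coprime.pow_right b (((by norm_num : Nat.Prime 7)).coprime_iff_not_dvd.mpr h7).symm)

/-- `J(n² | b) = 1` when `n` is a product of powers of `2` and `7` and `b` is odd and prime to `7`. [folklore] -/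
theorem jacobiSym_sq_eq_one_of_coprime {n : ℕ} {a c : ℕ} (hn : n = 2 ^ a * 7 ^ c) {b : ℕ}
    (h2 : ¬ 2 ∣ b) (h7 : ¬ 7 ∣ b) : J(((n : ℤ) ^ 2) | b) = 1 := by
  refine jacobiSym.sq_one' ?_
  rw [Int.gcd_natCast_natCast, hn]
  exact (coprime_two_pow_mul_seven_pow h2 h7 a c).symm

/-- **Root number and conductor of the GOOD twists**: for `d ≡ 1 (mod 4)` squarefree prime to `7`,
`w(49a1^{(d)}) = sign d` and `N(49a1^{(d)}) = 49 d²` (Murty–Murty 1997 Ch. 6 §1: `w(E^{(D)}) =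
(−1/|D|)(N_E/|D|) w(E)` for an odd fundamental discriminant `D` prime to `N_E`; here `(49/|d|) = 1` and
`w(X₀(49)) = 1`). [cite: MurtyMurty1997, Ch. 6 §1] [cite: AtkinLehner1970, §6] -/
theorem rootNumber_and_conductorNorm_quadraticTwist_cm7_of_emod_four_eq_one (hnf : exists_isNewformOf)
    (h12 : CoatesLiTianZhai2015.thm12_fullBSD_twist) {d : ℤ} (hd4 : d % 4 = 1) (hsq : Squarefree d)
    (h7 : ¬ (7 : ℤ) ∣ d) :
    (cm7.quadraticTwist (d : ℚ)).rootNumber = Int.sign d ∧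
      (cm7.quadraticTwist (d : ℚ)).conductorNorm ℤ = 49 * d.natAbs ^ 2 := by
  have hd2 : ¬ 2 ∣ d.natAbs := fun h ↦ by
    have : (2 : ℤ) ∣ d := Int.ofNat_dvd_left.mpr h
    omega
  have hd7 : ¬ 7 ∣ d.natAbs := fun h ↦ h7 (Int.ofNat_dvd_left.mpr h)
  have hgcd : Int.gcd d (cm7.conductorNorm ℤ) = 1 := by
    rw [conductorNorm_cm7, Int.gcd_eq_natAbs, Int.natAbs_natCast, show (49 : ℕ) = 2 ^ 0 * 7 ^ 2 by norm_num]
    exact coprime_two_pow_mul_seven_pow hd2 hd7 _ _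
  have h := cm7.rootNumber_quadraticTwist_of_emod_four_eq_one hnf hd4 hsq hgcd
  rw [conductorNorm_cm7, rootNumber_cm7 h12] at h
  refine ⟨?_, h.2⟩
  rw [h.1, Uniform.U2.jacobiSym_neg_one_natAbs_eq_sign hd4, show ((49 : ℕ) : ℤ) = (7 : ℕ) ^ 2 by norm_num,
    jacobiSym_sq_eq_one_of_coprime (show (7 : ℕ) = 2 ^ 0 * 7 ^ 1 by norm_num) hd2 hd7]
  ring

/-- **Root number and conductor along the three ADDITIVE fibres `d = ε·m`, `ε ∈ {−1, 2, −2}`,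
`m ≡ 1 (mod 4)`.** For `m ≡ 1 (mod 4)` squarefree with `7 ∤ m`: `w(49a1^{(ε m)}) = sign ε · sign m` and
`N(49a1^{(ε m)}) = N(49a1^{(ε)}) · m²` with `N(49a1^{(ε)}) = 28², 56², 56²` — the twist of the base curve
`49a1^{(ε)}` by the odd fundamental discriminant `m` prime to its conductor (Murty–Murty 1997 Ch. 6 §1:
`w(E^{(D)}) = (−1/|D|)(N_E/|D|) w(E)`, and `(N_E/|D|) = 1` because `N_E` is a square prime to `D`).
[cite: MurtyMurty1997, Ch. 6 §1] [cite: AtkinLehner1970, §6] -/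
theorem rootNumber_and_conductorNorm_quadraticTwist_cm7_fibre (hnf : exists_isNewformOf)
    (h12 : CoatesLiTianZhai2015.thm12_fullBSD_twist) {ε : ℤ} (hε : ε = -1 ∨ ε = 2 ∨ ε = -2)
    {m : ℤ} (hm4 : m % 4 = 1) (hsq : Squarefree m) (h7 : ¬ (7 : ℤ) ∣ m) :
    (cm7.quadraticTwist ((ε * m : ℤ) : ℚ)).rootNumber = Int.sign ε * Int.sign m ∧
      (cm7.quadraticTwist ((ε * m : ℤ) : ℚ)).conductorNorm ℤ =
        (cm7.quadraticTwist (ε : ℚ)).conductorNorm ℤ * m.natAbs ^ 2 := by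
  have hε0 : ε ≠ 0 := by rcases hε with rfl | rfl | rfl <;> decide
  have hεQ : (ε : ℚ) ≠ 0 := Int.cast_ne_zero.mpr hε0
  haveI := cm7.isElliptic_quadraticTwist hεQ
  -- the base curve `B = cm7^{(ε)}`: root number `sign ε`, conductor `n²` with `n ∈ {28, 56}`
  obtain ⟨n, a, c, hn, hwB, hNB⟩ : ∃ n a c : ℕ, n = 2 ^ a * 7 ^ c ∧
      (cm7.quadraticTwist (ε : ℚ)).rootNumber = Int.sign ε ∧
      (cm7.quadraticTwist (ε : ℚ)).conductorNorm ℤ = n ^ 2 := by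
    have h := rootNumber_and_conductorNorm_quadraticTwist_cm7_base hnf h12 hε
    rcases hε with rfl | rfl | rfl
    · exact ⟨28, 2, 1, by norm_num, h.1, by rw [h.2]; norm_num⟩
    · exact ⟨56, 3, 1, by norm_num, h.1, by rw [h.2]; norm_num⟩
    · exact ⟨56, 3, 1, by norm_num, h.1, by rw [h.2]; norm_num⟩
  -- `m` is odd and prime to `7`, hence prime to `N_B`
  have hm2 : ¬ 2 ∣ m.natAbs := fun h ↦ by
    have : (2 : ℤ) ∣ m := Int.ofNat_dvd_left.mpr h
    omega
  have hm7 : ¬ 7 ∣ m.natAbs := fun h ↦ h7 (Int.ofNat_dvd_left.mpr h)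
  have hgcd : Int.gcd m ((cm7.quadraticTwist (ε : ℚ)).conductorNorm ℤ) = 1 := by
    rw [hNB, Int.gcd_eq_natAbs, Int.natAbs_natCast, hn, mul_pow, ← pow_mul, ← pow_mul]
    exact coprime_two_pow_mul_seven_pow hm2 hm7 _ _
  have h := (cm7.quadraticTwist (ε : ℚ)).rootNumber_quadraticTwist_of_emod_four_eq_one hnf hm4 hsq hgcd
  rw [quadraticTwist_quadraticTwist, ← Int.cast_mul] at h
  refine ⟨?_, h.2⟩
  rw [h.1, hwB, hNB, Uniform.U2.jacobiSym_neg_one_natAbs_eq_sign hm4, Nat.cast_pow,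
    jacobiSym_sq_eq_one_of_coprime hn hm2 hm7]
  ring

/-- **`w(49a1^{(d)}) = sign d` for every squarefree `d` prime to `7`** (good AND additive twists alike):
write `d = ε m` with `ε ∈ {1, −1, 2, −2}` and `m ≡ 1 (mod 4)` (file 3's
`exists_base_and_good_twist_of_squarefree_of_emod_four_ne_one` for `d ≢ 1 (mod 4)`) and apply the fibre
formulas. In words: `w(X₀(49) ⊗ χ_d) = χ_d(−49) w(X₀(49)) = χ_d(−1)` for `(d, 7) = 1` — the additive
twists with `r_an` odd are exactly the NEGATIVE ones. [cite: MurtyMurty1997, Ch. 6 §1] -/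
theorem rootNumber_quadraticTwist_cm7 (hnf : exists_isNewformOf)
    (h12 : CoatesLiTianZhai2015.thm12_fullBSD_twist) {d : ℤ} (hsq : Squarefree d) (h7 : ¬ (7 : ℤ) ∣ d) :
    (cm7.quadraticTwist (d : ℚ)).rootNumber = Int.sign d := by
  by_cases hd4 : d % 4 = 1
  · exact (rootNumber_and_conductorNorm_quadraticTwist_cm7_of_emod_four_eq_one hnf h12 hd4 hsq h7).1
  · obtain ⟨ε, m, hε, hm4, hsqm, rfl⟩ := exists_base_and_good_twist_of_squarefree_of_emod_four_ne_one hsq hd4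
    have h7m : ¬ (7 : ℤ) ∣ m := fun h ↦ h7 (dvd_mul_of_dvd_right h ε)
    rw [(rootNumber_and_conductorNorm_quadraticTwist_cm7_fibre hnf h12 hε hm4 hsqm h7m).1, Int.sign_mul]

/-- **Conductor of the additive twists**: for `d = ε m` squarefree prime to `7` with `ε ∈ {−1, 2, −2}`,
`m ≡ 1 (mod 4)`: `N(49a1^{(d)}) = 784 m²` (`ε = −1`, i.e. `d ≡ 3 (mod 4)`) resp. `3136 m²` (`ε = ±2`,
i.e. `d` even) — `2⁴·7²·m²` / `2⁶·7²·m²`, as recorded numerically in the cell memo TWINPP-LEAF §1.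
[cite: AtkinLehner1970, §6] [cite: MurtyMurty1997, Ch. 6 §1] -/
theorem conductorNorm_quadraticTwist_cm7_base_mul (hnf : exists_isNewformOf)
    (h12 : CoatesLiTianZhai2015.thm12_fullBSD_twist) {ε : ℤ} (hε : ε = -1 ∨ ε = 2 ∨ ε = -2)
    {m : ℤ} (hm4 : m % 4 = 1) (hsq : Squarefree m) (h7 : ¬ (7 : ℤ) ∣ m) :
    (cm7.quadraticTwist ((ε * m : ℤ) : ℚ)).conductorNorm ℤ = (if ε = -1 then 784 else 3136) * m.natAbs ^ 2 := by
  rw [(rootNumber_and_conductorNorm_quadraticTwist_cm7_fibre hnf h12 hε hm4 hsq h7).2,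
    (rootNumber_and_conductorNorm_quadraticTwist_cm7_base hnf h12 hε).2]
  rcases hε with rfl | rfl | rfl <;> norm_num

end Summit.BirchSwinnertonDyer.BirchSwinnertonDyer.Theorems.GoldfeldGoodTwists

end
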